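import Mathlib

/-!
# Ladder duality: swapping sides and reversing the class order (support file)

Item `stmt-MatrixMultiplication-14308` (`FourierTwoFamiliesModP.PrimeTwoFamilies`, CKSU 2005
Conj. 4.7 with prime cyclic hosts), line Sketch, stub `isLadder_reverse`.

Line Sketch reduces the conjecture to the cyclic LADDER conjecture about ordered families
`(X c, Y c)_{c < r}` of finite subsets of an abelian group with

* (directness, `hW`) each class is direct: `(x - x') + (y - y') = 0` forces `x = x'` and
  `y = y'` for `x, x' ∈ X c`, `y, y' ∈ Y c`;
* (one-directional separation, `hL`) for `p < q` the lower cross differences `y' - x'`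
  (`x' ∈ X p`, `y' ∈ Y q`) avoid every diagonal difference `y - x` (`x ∈ X c`, `y ∈ Y c`).

Ladders are not symmetric under swapping the two sides alone, but they are symmetric under
swapping `X ↔ Y` AND reversing the class order `c ↦ Fin.rev c`: all differences get negated and
`p < q ↔ Fin.rev q < Fin.rev p`.  This transfers every right-side lemma to the left side.
-/

-- single-conjunct summit: the mandated namespace repeats `MatrixMultiplication` (summit = sub-problem).
set_option linter.dupNamespace false

namespace Summit.MatrixMultiplication.MatrixMultiplication.Theorems.PrimeTwoFamilies.LadderLift

/-- **Ladder duality.**  If `(X c, Y c)_{c < r}` is a ladder (each class direct, `hW`, and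
one-directionally separated, `hL`), then so is the family obtained by swapping the two sides and
reversing the class order, `c ↦ (Y (Fin.rev c), X (Fin.rev c))`. -/
theorem isLadder_reverse {G : Type*} [AddCommGroup G] {r : ℕ} (X Y : Fin r → Finset G)
    (hW : ∀ c : Fin r, ∀ x ∈ X c, ∀ x' ∈ X c, ∀ y ∈ Y c, ∀ y' ∈ Y c,
      (x - x') + (y - y') = 0 → x = x' ∧ y = y')
    (hL : ∀ c p q : Fin r, p < q → ∀ x ∈ X c, ∀ y ∈ Y c, ∀ x' ∈ X p, ∀ y' ∈ Y q,
      y - x ≠ y' - x') :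
    (∀ c : Fin r, ∀ x ∈ Y (Fin.rev c), ∀ x' ∈ Y (Fin.rev c), ∀ y ∈ X (Fin.rev c),
        ∀ y' ∈ X (Fin.rev c), (x - x') + (y - y') = 0 → x = x' ∧ y = y') ∧
    (∀ c p q : Fin r, p < q → ∀ x ∈ Y (Fin.rev c), ∀ y ∈ X (Fin.rev c),
        ∀ x' ∈ Y (Fin.rev p), ∀ y' ∈ X (Fin.rev q), y - x ≠ y' - x') := by
  refine ⟨fun c x hx x' hx' y hy y' hy' h => ?_, fun c p q hpq x hx y hy x' hx' y' hy' h => ?_⟩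
  · -- directness of the swapped class: commute the two summands and apply `hW (Fin.rev c)`.
    have key := hW (Fin.rev c) y hy y' hy' x hx x' hx' (by rwa [add_comm] at h)
    exact ⟨key.2, key.1⟩
  · -- separation: `p < q` gives `Fin.rev q < Fin.rev p`; negate the forbidden coincidence.
    have key :=
      hL (Fin.rev c) (Fin.rev q) (Fin.rev p) (Fin.rev_lt_rev.2 hpq) y hy x hx y' hy' x' hx'
    exact key (by rw [← neg_sub y x, h, neg_sub])
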